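import Mathlib
import HarnessLib
import Summits.HubbardSuperconductivity.HubbardSuperconductivity.Theorems.KLProgrammeKLRegimeTwoLegCurvatureConsts
import Summits.HubbardSuperconductivity.HubbardSuperconductivity.Theorems.KLProgrammeKLRegimeSplitFlowPieceOscDefs

/-!
# K3 ENGINE / engine-flow child `KLRegimeEngineV17F2` (stmt-HubbardSuperconductivity-20437), v2 TOKEN #26 (plan g19 (R59bg), KL STATUS 2026-08-27 l.3711):
# the (C)-lane constant `klReadOscC P R` of the MEAN-FREE value clause `TwoLegReadOscAt L M (klReadOscC P R) β U μ K_n n`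

Cell `gate-hubbard-kl`, lane hubbard-kl-c4a-1 (C4a inductive tangential bound; g4), the (C) lane's (Q-C) word (memo HOME/hubbard-kl-c4a-1/C4A-PLAN.md §17).

WHAT.  `klReadOscC P R := 2 · klC4aJetC′ P R 0 = 2^21 · (klEngQ5 P R).S′ 0` — TWICE the `|U|`-suppressed `k = 0` entry of stub (C)'s own curve-jet
table (`…TwoLegCurvatureConsts`: at `k = 0` the bar is `(klC4aJetC 0 + klC4aJetC′ P R 0·|U|)·|U|·16^{−n}`; the ABSOLUTE entry `klC4aJetC 0·|U|·16^{−n}`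
is the budget of the FIRST-ORDER part of the reading — slice tadpoles, frame constants —, which is θ-CONSTANT EXACTLY (on-site interaction: the Hartree
self-energy is momentum-independent at every frame; `symInterp`/`jacksonFrame`/`klFrameExtFn` reproduce constants); the `|U|`-suppressed entry
`klC4aJetC′ P R 0·U²·16^{−n}` is the budget of the orders `≥ 2`).  Hence the (C) closer, which proves its `k = 0` clause in the STRUCTURED form
`ν_n(K_n)(θ) = a_n + r_n(θ)`, `a_n` θ-free, `|r_n(θ)| ≤ klC4aJetC′ P R 0·U²·4^{−2n}`, gets the appended conjunct for free through r2d-p1's producer door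
`twoLegReadOscAt_of_abs_sub_const_le` (a reading within `c″/2·U²·4^{−2n}` of ANY constant satisfies `TwoLegReadOscAt … c″ …`): `c″ := klReadOscC P R`.
It is a CLOSED TERM of the render context `(P, R, …)` of 20437 (not an `R.Gfr` slot, not a `Q`/`P` field), `m`-free and `U`-free, as (R59bg) requires; the
(b)-history conjunct reads the same symbol (`FlowPieceOscAt L M (klReadOscC P R) β U μ m`, bridge `flowPieceOscAt_of_readOscAt`, same constant).

WHY NOT A NUMERAL.  The second-order per-scale value oscillation is numerically tiny (lane c4a-1 re-read of kit j275159, memo §17: per-octave increments of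
`osc_θ Re Σ₂(iπT, k_F(θ))` are `(0.03 … 0.08)·U²·T²` on `klWindowC`, i.e. `≲ 10⁻⁴` in the `U²·16^{−n}` normalisation), but orders `≥ 3` are booked — as
everywhere in the engine child — against the package slack `(klEngQ5 P R).S′`, which is not a numeral; the table therefore follows `klC4aJetC′`.
Consumers needing `c·klReadOscC P R ≤ X` (CD-LIMITS / token #19) read `klReadOscC_eq` and size `c` accordingly (no definitional cycle: `klEngQ5` is
upstream of every `C₃`/`U₀` threshold of the child).

* §1 the constant, `klReadOscC_eq` / `_eq_two_mul`, nonnegativity, `klReadOscC_div_two`;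
* §2 THE PRODUCER DOOR AT THIS CONSTANT: `twoLegReadOscAt_klReadOscC_of_abs_sub_const_le` (structured `k = 0` clause ⇒ the conjunct) and its
  `TwoLegReadJetBound`-keyed form; `curveJetBar_klC4aJetC_zero_eq` (the `k = 0` bar splits as first-order budget + `klReadOscC/2·U²·4^{−2n}`).

Definitions of real constants + bookkeeping; nothing is asserted about the Hubbard model (whether stub (C)'s lane supplies the structured `k = 0` clause is
its proof obligation, memo §17: value-level odd-pairing lemma + (L3-val) dominators); nothing here asserts K3 or superconductivity.
References: BGM 2006 §2.4 (2.36) [cite: BenfattoGiulianiMastropietro2006] (`C₀|U|` value law — tadpole first order, momentum-independent; `C_jU²`).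
-/

noncomputable section

namespace Summit.HubbardSuperconductivity.HubbardSuperconductivity.Theorems.KLRegimeSplit

set_option linter.dupNamespace false -- summit = problem name (single-conjunct summit), D-0017

open Real Literature.MathematicalPhysics.QuantumLattice Literature.Probability.LatticeModels
open Summit.HubbardSuperconductivity.HubbardSuperconductivity.Theorems.EngineV8

/-! ## §1 The constant -/

/-- **`klReadOscC P R := 2 · klC4aJetC′ P R 0`** — token #26: the constant of the mean-free value clause
`TwoLegReadOscAt L M (klReadOscC P R) β U μ (klFlowFrameU … n) n` appended to stub (C)'s conclusion, and of the (b)-history conjunct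
`FlowPieceOscAt L M (klReadOscC P R) β U μ m`.  Twice the `|U|`-suppressed `k = 0` entry of (C)'s curve-jet table (the orders-`≥ 2` value budget;
the first-order part of the reading is θ-constant and drops from the oscillation exactly). -/
def klReadOscC (P : SplitConsts) (R : RenConsts) : ℝ := 2 * klC4aJetC' P R 0

/-- `klReadOscC P R = 2 · klC4aJetC′ P R 0`. -/
theorem klReadOscC_eq_two_mul (P : SplitConsts) (R : RenConsts) : klReadOscC P R = 2 * klC4aJetC' P R 0 := rfl

/-- **`klReadOscC P R = 2^21 · (klEngQ5 P R).S′ 0`** (the closed form consumers size thresholds against). -/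
theorem klReadOscC_eq (P : SplitConsts) (R : RenConsts) : klReadOscC P R = 2 ^ 21 * (klEngQ5 P R).S' 0 := by
  rw [klReadOscC, klC4aJetC'_eq]; ring

/-- `klReadOscC P R / 2 = klC4aJetC′ P R 0` — the half-constant the producer door is fed. -/
theorem klReadOscC_div_two (P : SplitConsts) (R : RenConsts) : klReadOscC P R / 2 = klC4aJetC' P R 0 := by
  rw [klReadOscC]; ring

/-- `0 ≤ klReadOscC P R`. -/
theorem klReadOscC_nonneg (P : SplitConsts) (R : RenConsts) : 0 ≤ klReadOscC P R := by
  rw [klReadOscC]; exact mul_nonneg (by norm_num) (klC4aJetC'_nonneg P R 0)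

/-- `klC4aJetC′ P R 0 ≤ klReadOscC P R` (the table entry is below the token). -/
theorem klC4aJetC'_zero_le_klReadOscC (P : SplitConsts) (R : RenConsts) : klC4aJetC' P R 0 ≤ klReadOscC P R := by
  rw [klReadOscC]; linarith [klC4aJetC'_nonneg P R 0]

/-- **The `k = 0` bar of (C)'s table splits** as the first-order budget plus `klReadOscC/2 · U² · 4^{−2n}`:
`curveJetBar klC4aJetC (klC4aJetC′ P R) U 0 n = klC4aJetC 0·|U|·4^{−2n} + (klReadOscC P R / 2)·U²·4^{−2n}`. -/
theorem curveJetBar_klC4aJetC_zero_eq (P : SplitConsts) (R : RenConsts) (U : ℝ) (n : ℕ) :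
    curveJetBar klC4aJetC (klC4aJetC' P R) U 0 n =
      klC4aJetC 0 * |U| * (4 : ℝ) ^ (-2 * (n : ℤ)) + klReadOscC P R / 2 * U ^ 2 * (4 : ℝ) ^ (-2 * (n : ℤ)) := by
  rw [curveJetBar_apply, uPow_zero, klReadOscC_div_two, ← sq_abs U]
  push_cast
  ring

/-! ## §2 The producer door at this constant (how stub (C)'s closer discharges the appended conjunct) -/

section Model

variable {L M : ℕ} [NeZero L] [NeZero M]

/-- **PRODUCER DOOR at `klReadOscC`**: if the scale-`n` reading on the frame `K` is continuous and within `klC4aJetC′ P R 0 · U² · 4^{−2n}` of SOME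
constant `τ` (the structured `k = 0` clause: `τ` = its θ-constant first-order part), then `TwoLegReadOscAt L M (klReadOscC P R) β U μ K n`. -/
theorem twoLegReadOscAt_klReadOscC_of_abs_sub_const_le {P : SplitConsts} {R : RenConsts} {β U μ : ℝ} {K : TrigPolyC4v} {n : ℕ}
    (hf : Continuous fun θ : ℝ => klLocalPart L M β U μ K n θ) (τ : ℝ)
    (h : ∀ θ, |klLocalPart L M β U μ K n θ - τ| ≤ klC4aJetC' P R 0 * U ^ 2 * (4 : ℝ) ^ (-2 * (n : ℤ))) :
    TwoLegReadOscAt L M (klReadOscC P R) β U μ K n :=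
  twoLegReadOscAt_of_abs_sub_const_le hf τ fun θ => by rw [klReadOscC_div_two]; exact h θ

/-- The producer door with continuity read from the reading-jet predicate `TwoLegReadJetBound … K n` (stub (C)'s registered conclusion). -/
theorem twoLegReadOscAt_klReadOscC_of_readJetBound {P : SplitConsts} {R : RenConsts} {β U μ : ℝ} {K : TrigPolyC4v} {n : ℕ}
    {c c' : ℕ → ℝ} (hJ : TwoLegReadJetBound L M c c' β U μ K n) (τ : ℝ)
    (h : ∀ θ, |klLocalPart L M β U μ K n θ - τ| ≤ klC4aJetC' P R 0 * U ^ 2 * (4 : ℝ) ^ (-2 * (n : ℤ))) :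
    TwoLegReadOscAt L M (klReadOscC P R) β U μ K n :=
  twoLegReadOscAt_klReadOscC_of_abs_sub_const_le hJ.1.continuous τ h

/-- **The structured `k = 0` clause also gives the registered VALUE clause**: `|ν| ≤ |τ| + klC4aJetC′ P R 0·U²·4^{−2n}`, so with the first-order budget
`|τ| ≤ klC4aJetC 0·|U|·4^{−2n}` the `k = 0` bar `curveJetBar klC4aJetC (klC4aJetC′ P R) U 0 n` follows — ONE structured estimate serves both conjuncts. -/
theorem abs_klLocalPart_le_curveJetBar_zero_of_structured {P : SplitConsts} {R : RenConsts} {β U μ : ℝ} {K : TrigPolyC4v} {n : ℕ}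
    (τ : ℝ) (hτ : |τ| ≤ klC4aJetC 0 * |U| * (4 : ℝ) ^ (-2 * (n : ℤ)))
    (h : ∀ θ, |klLocalPart L M β U μ K n θ - τ| ≤ klC4aJetC' P R 0 * U ^ 2 * (4 : ℝ) ^ (-2 * (n : ℤ))) (θ : ℝ) :
    |klLocalPart L M β U μ K n θ| ≤ curveJetBar klC4aJetC (klC4aJetC' P R) U 0 n := by
  rw [curveJetBar_klC4aJetC_zero_eq, klReadOscC_div_two]
  calc |klLocalPart L M β U μ K n θ| = |τ + (klLocalPart L M β U μ K n θ - τ)| := by ring_nf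
    _ ≤ |τ| + |klLocalPart L M β U μ K n θ - τ| := abs_add_le _ _
    _ ≤ _ := add_le_add hτ (h θ)

end Model

end Summit.HubbardSuperconductivity.HubbardSuperconductivity.Theorems.KLRegimeSplit

end
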